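import Summits.NavierStokesRegularity.NavierStokesRegularity.Theorems.PerpetualPumpAveragedTypeIBlowupWellposedRestart

/-!
# Crux `PerpetualPump.AveragedTypeIBlowup` (stmt-NavierStokesRegularity-1835), line `Sketch`:
# tools for the stub `wellposed` — one marching step of the persistence argument

T. Tao, *Finite time blowup for an averaged three-dimensional Navier–Stokes equation*, J. Amer.
Math. Soc. **29** (2016), 601–674 = arXiv:1402.0290v3, §4, p. 22 (4.14): the wavelet coefficients of
a mild solution of the cascade equation solve the exact Volterra chain
`Y_{i,n}(t) = A 1_{(i,n)=(i₀,n₀)} k_{i,n}(t) + ∫₀ᵗ k_{i,n}(t-s) quadTerm(Y)_{i,n}(s) ds`, `|k_{i,n}| ≤ 1`.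

Helper file (theorems only) for the registered stub `stub_wellposed` of the lead's skeleton
`Cruxes/AveragedTypeIBlowup/Lines/Sketch.lean`, for general continuous kernels `|k_{i,n}| ≤ 1`:
`persist_step`, the marching step of the persistence argument — a solution `Z` from the datum `A'`
on `[0,a]`, `D`-close (`D ≤ 1`) in the weight `(1+ε₀)^{20n}` to the reference solution `Y` from `A`,
is continued by the Picard theorem `stub_chainContinuationPicard` (passed as a hypothesis, for the
size `R` of all restart forcings) to `[0,b]`, `b - a` at most the Picard time and `(b-a)Λ₂ ≤ ½`, and
the continuation is `2(1+ε₀)^{20n₀}|A'-A| + (2TΛ₁+1)D`-close to `Y` (restart both chains at `a`,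
`restart_dist_le`, glue at `a`). Iterating it `⌈T/h⌉` times is `persist_of_kernel` of the stub file.

Nothing here closes the item (`--supports`); no statement of the route changes.

## References

* T. Tao, J. Amer. Math. Soc. 29 (2016), 601–674, arXiv:1402.0290v3, §4 p. 22 (4.14).
  [`Tao2016AveragedNS`]
-/

noncomputable section

-- the summit namespace `…NavierStokesRegularity.NavierStokesRegularity…` is the tree convention
set_option linter.dupNamespace false

open MeasureTheory Set Filter Topology
open scoped ENNReal
open Literature.Analysis.FluidPDE
open Literature.Analysis.FluidPDE.TaoCascade (quadTerm shiftSet mem_shiftSet_iff)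

namespace Summit.NavierStokesRegularity.NavierStokesRegularity.Theorems.PerpetualPumpAveragedTypeIBlowup

variable {ε₀ : ℝ} {m : ℕ}

/-! ### One marching step of the persistence argument -/

/-- **One marching step.** Let `Y` solve the chain from the datum `A` on `[0,T]` (continuous, no modes
below `n₀`, `(1+ε₀)^{20n}|Y| ≤ ρ_Y`), and let `Z` (continuous, no modes below `n₀`) solve the chain from
`A'`, `|A'-A| ≤ 1`, on `[0,a]` with `(1+ε₀)^{20n}|Y - Z| ≤ D ≤ 1` there. Let `R` dominate
`(1+ε₀)^{20n₀}(|A|+1) + TΛ₁(ρ_Y+1)` (`Λ₁ = 2K(ρ_Y+1)(1+ε₀)^{75/2-35n₀/2}`) and `ρ_Y ≤ 2R+1`, let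
`(b-a)Λ₂ ≤ ½` (`Λ₂` the same modulus at size `2R+1`), `a ≤ b ≤ T`, and assume the Picard solvability on
`[a,b]` of every restarted chain with continuous forcing of weighted size `≤ R` vanishing below `n₀`
(`stub_chainContinuationPicard`). Then `Z` extends to a continuous solution `Z'` from `A'` on `[0,b]`, no
modes below `n₀`, with `(1+ε₀)^{20n}|Y - Z'| ≤ 2(1+ε₀)^{20n₀}|A'-A| + (2TΛ₁+1)D` on `[0,b]`: restart both
chains at `a` (memory `∫₀ᵃ` into the forcing, forcings `(1+ε₀)^{20n₀}|A'-A| + TΛ₁D`-close by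
`weighted_volterra_sub_le`), solve the restarted chain of `Z` on `[a,b]` by Picard, compare with `Y` by
`restart_dist_le`, and glue at `a`. [cite: Tao2016AveragedNS, §4 p. 22 (4.14)] -/
theorem persist_step (hε₀ : 0 < ε₀) (α : Fin m → Fin m → Fin m → ℤ × ℤ × ℤ → ℝ)
    (k : Fin m → ℤ → ℝ → ℝ) (hk1 : ∀ i n τ, |k i n τ| ≤ 1) (hkc : ∀ i n, Continuous (k i n))
    (i₀ : Fin m) (n₀ : ℤ) {K Λ₁ Λ₂ A A' T a b ρY R D : ℝ}
    (hK : K = ∑ i₃ : Fin m, ∑ i₁ : Fin m, ∑ i₂ : Fin m, ∑ μ ∈ shiftSet, |α i₁ i₂ i₃ μ|)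
    (hΛ₁ : Λ₁ = K * (2 * (ρY + 1)) * (1 + ε₀) ^ ((75 : ℝ) / 2 - (35 : ℝ) / 2 * n₀))
    (hΛ₂ : Λ₂ = K * (2 * (2 * R + 1)) * (1 + ε₀) ^ ((75 : ℝ) / 2 - (35 : ℝ) / 2 * n₀))
    (ha : 0 ≤ a) (hab : a ≤ b) (hbT : b ≤ T) (hρY : 0 ≤ ρY) (hD0 : 0 ≤ D) (hD1 : D ≤ 1)
    (hA' : |A' - A| ≤ 1)
    (hR : (1 + ε₀) ^ ((20 : ℝ) * n₀) * (|A| + 1) + T * Λ₁ * (ρY + 1) ≤ R) (hRρ : ρY ≤ 2 * R + 1)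
    (hbΛ : (b - a) * Λ₂ ≤ 1 / 2)
    (hP : ∀ F : Fin m → ℤ → ℝ → ℝ, (∀ i n, Continuous (F i n)) → (∀ i n t, n < n₀ → F i n t = 0) →
      (∀ (i : Fin m) (n : ℤ) (t : ℝ), (1 + ε₀) ^ ((20 : ℝ) * n) * |F i n t| ≤ R) →
      ∃ X : Fin m → ℤ → ℝ → ℝ, (∀ i n, Continuous (X i n)) ∧ (∀ i n t, n < n₀ → X i n t = 0) ∧
        (∀ (i : Fin m) (n : ℤ) (t : ℝ), (1 + ε₀) ^ ((20 : ℝ) * n) * |X i n t| ≤ 2 * R + 1) ∧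
        (∀ (i : Fin m) (n : ℤ), ∀ t ∈ Icc a b,
          X i n t = F i n t + ∫ s in a..t, k i n (t - s) * quadTerm ε₀ α X i n s))
    {Y Z : Fin m → ℤ → ℝ → ℝ}
    (hYc : ∀ i n, ContinuousOn (Y i n) (Icc 0 T)) (hY0 : ∀ i n t, n < n₀ → Y i n t = 0)
    (hYb : ∀ (i : Fin m) (n : ℤ), ∀ t ∈ Icc 0 T, (1 + ε₀) ^ ((20 : ℝ) * n) * |Y i n t| ≤ ρY)
    (hYeq : ∀ (i : Fin m) (n : ℤ), ∀ t ∈ Icc 0 T,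
      Y i n t = (if i = i₀ ∧ n = n₀ then A else 0) * k i n t +
        ∫ s in (0 : ℝ)..t, k i n (t - s) * quadTerm ε₀ α Y i n s)
    (hZc : ∀ i n, Continuous (Z i n)) (hZ0 : ∀ i n t, n < n₀ → Z i n t = 0)
    (hZeq : ∀ (i : Fin m) (n : ℤ), ∀ t ∈ Icc 0 a,
      Z i n t = (if i = i₀ ∧ n = n₀ then A' else 0) * k i n t +
        ∫ s in (0 : ℝ)..t, k i n (t - s) * quadTerm ε₀ α Z i n s)
    (hZd : ∀ (i : Fin m) (n : ℤ), ∀ t ∈ Icc 0 a, (1 + ε₀) ^ ((20 : ℝ) * n) * |Y i n t - Z i n t| ≤ D) :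
    ∃ Z' : Fin m → ℤ → ℝ → ℝ, (∀ i n, Continuous (Z' i n)) ∧ (∀ i n t, n < n₀ → Z' i n t = 0) ∧
      (∀ (i : Fin m) (n : ℤ), ∀ t ∈ Icc 0 b,
        Z' i n t = (if i = i₀ ∧ n = n₀ then A' else 0) * k i n t +
          ∫ s in (0 : ℝ)..t, k i n (t - s) * quadTerm ε₀ α Z' i n s) ∧
      ∀ (i : Fin m) (n : ℤ), ∀ t ∈ Icc 0 b, (1 + ε₀) ^ ((20 : ℝ) * n) * |Y i n t - Z' i n t| ≤
        2 * ((1 + ε₀) ^ ((20 : ℝ) * n₀) * |A' - A|) + (2 * (T * Λ₁) + 1) * D := by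
  have hL0 : 0 < 1 + ε₀ := by linarith
  have hK0 : 0 ≤ K := by rw [hK]; positivity
  have hρ : 0 ≤ ρY + 1 := by linarith
  have hΛ₁0 : 0 ≤ Λ₁ := by rw [hΛ₁]; positivity
  have hT0 : 0 ≤ T := ha.trans (hab.trans hbT)
  have hR0 : 0 ≤ R := le_trans (by positivity) hR
  have hIccT : Icc 0 a ⊆ Icc 0 T := fun s hs => ⟨hs.1, hs.2.trans (hab.trans hbT)⟩
  have hIccT' : Icc a b ⊆ Icc 0 T := fun s hs => ⟨ha.trans hs.1, hs.2.trans hbT⟩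
  -- clamps onto `[0, a]`
  have hcl : ∀ s, max 0 (min s a) ∈ Icc 0 a := fun s =>
    ⟨le_max_left _ _, max_le ha (min_le_right _ _)⟩
  have hclid : ∀ s ∈ Icc 0 a, max 0 (min s a) = s := fun s hs => by
    rw [min_eq_left hs.2, max_eq_right hs.1]
  have hcc : Continuous fun s : ℝ => max 0 (min s a) :=
    continuous_const.max (continuous_id.min continuous_const)
  obtain ⟨Yc, hYc'⟩ : ∃ Yc : Fin m → ℤ → ℝ → ℝ, ∀ j k' s, Yc j k' s = Y j k' (max 0 (min s a)) :=
    ⟨_, fun _ _ _ => rfl⟩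
  obtain ⟨Zc, hZc'⟩ : ∃ Zc : Fin m → ℤ → ℝ → ℝ, ∀ j k' s, Zc j k' s = Z j k' (max 0 (min s a)) :=
    ⟨_, fun _ _ _ => rfl⟩
  have hYcc : ∀ j k', Continuous (Yc j k') := fun j k' => by
    rw [show Yc j k' = fun s => Y j k' (max 0 (min s a)) from funext (hYc' j k')]
    exact (hYc j k').comp_continuous hcc fun s => hIccT (hcl s)
  have hZcc : ∀ j k', Continuous (Zc j k') := fun j k' => by
    rw [show Zc j k' = fun s => Z j k' (max 0 (min s a)) from funext (hZc' j k')]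
    exact (hZc j k').comp hcc
  have hYcY : ∀ j k', ∀ s ∈ Icc 0 a, Yc j k' s = Y j k' s := fun j k' s hs => by
    rw [hYc', hclid s hs]
  have hZcZ : ∀ j k', ∀ s ∈ Icc 0 a, Zc j k' s = Z j k' s := fun j k' s hs => by
    rw [hZc', hclid s hs]
  have hYc0 : ∀ j k' s, k' < n₀ → Yc j k' s = 0 := fun j k' s hk' => by
    rw [hYc']
    exact hY0 j k' _ hk'
  have hZc0 : ∀ j k' s, k' < n₀ → Zc j k' s = 0 := fun j k' s hk' => by
    rw [hZc']
    exact hZ0 j k' _ hk'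
  -- weighted sizes and distance
  have hZb : ∀ (j : Fin m) (k' : ℤ), ∀ s ∈ Icc 0 a, (1 + ε₀) ^ ((20 : ℝ) * k') * |Z j k' s| ≤ ρY + 1 :=
    fun j k' s hs => by
      have h3 : |Z j k' s| ≤ |Y j k' s| + |Y j k' s - Z j k' s| := by
        have := abs_sub_abs_le_abs_sub (Z j k' s) (Y j k' s)
        rw [abs_sub_comm] at this
        linarith
      calc (1 + ε₀) ^ ((20 : ℝ) * k') * |Z j k' s|
          ≤ (1 + ε₀) ^ ((20 : ℝ) * k') * (|Y j k' s| + |Y j k' s - Z j k' s|) :=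
            mul_le_mul_of_nonneg_left h3 (Real.rpow_nonneg hL0.le _)
        _ ≤ ρY + D := by rw [mul_add]; exact add_le_add (hYb j k' s (hIccT hs)) (hZd j k' s hs)
        _ ≤ ρY + 1 := by linarith
  have hYcb : ∀ (j : Fin m) (k' : ℤ) (s : ℝ), |Yc j k' s| ≤ (ρY + 1) * (1 + ε₀) ^ (-((20 : ℝ) * k')) :=
    fun j k' s => by
      rw [hYc']
      exact (weight_mul_abs_le_iff hL0 _ _ _).1 ((hYb j k' _ (hIccT (hcl s))).trans (by linarith))
  have hZcb : ∀ (j : Fin m) (k' : ℤ) (s : ℝ), |Zc j k' s| ≤ (ρY + 1) * (1 + ε₀) ^ (-((20 : ℝ) * k')) :=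
    fun j k' s => by
      rw [hZc']
      exact (weight_mul_abs_le_iff hL0 _ _ _).1 (hZb j k' _ (hcl s))
  have hdc : ∀ (j : Fin m) (k' : ℤ) (s : ℝ),
      |Yc j k' s - Zc j k' s| ≤ D * (1 + ε₀) ^ (-((20 : ℝ) * k')) := fun j k' s => by
    rw [hYc', hZc']
    exact (weight_mul_abs_le_iff hL0 _ _ _).1 (hZd j k' _ (hcl s))
  -- the forcings of the two restarted chains
  obtain ⟨F, hF⟩ : ∃ F : Fin m → ℤ → ℝ → ℝ, ∀ i n t, F i n t = (if i = i₀ ∧ n = n₀ then A else 0) * k i n t +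
      ∫ s in (0 : ℝ)..a, k i n (t - s) * quadTerm ε₀ α Yc i n s := ⟨_, fun _ _ _ => rfl⟩
  obtain ⟨F', hF'⟩ : ∃ F' : Fin m → ℤ → ℝ → ℝ, ∀ i n t,
      F' i n t = (if i = i₀ ∧ n = n₀ then A' else 0) * k i n t +
        ∫ s in (0 : ℝ)..a, k i n (t - s) * quadTerm ε₀ α Zc i n s := ⟨_, fun _ _ _ => rfl⟩
  have hF'c : ∀ i n, Continuous (F' i n) := fun i n => by
    rw [show F' i n = fun t => (if i = i₀ ∧ n = n₀ then A' else 0) * k i n t +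
      ∫ s in (0 : ℝ)..a, k i n (t - s) * quadTerm ε₀ α Zc i n s from funext (hF' i n)]
    refine (continuous_const.mul (hkc i n)).add ?_
    exact intervalIntegral.continuous_parametric_intervalIntegral_of_continuous'
      (((hkc i n).comp (continuous_fst.sub continuous_snd)).mul
        ((continuous_quadTerm α hZcc i n).comp continuous_snd)) 0 a
  have hF'0 : ∀ i n t, n < n₀ → F' i n t = 0 := fun i n t hn => by
    have hne : ¬(i = i₀ ∧ n = n₀) := fun h => by
      rw [h.2] at hn
      exact lt_irrefl _ hn
    rw [hF', if_neg hne, zero_mul, zero_add]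
    simp only [quadTerm_eq_zero_of_lt α hZc0 i hn, mul_zero, intervalIntegral.integral_zero]
  have hF0 : ∀ i n t, n < n₀ → F i n t = 0 := fun i n t hn => by
    have hne : ¬(i = i₀ ∧ n = n₀) := fun h => by
      rw [h.2] at hn
      exact lt_irrefl _ hn
    rw [hF, if_neg hne, zero_mul, zero_add]
    simp only [quadTerm_eq_zero_of_lt α hYc0 i hn, mul_zero, intervalIntegral.integral_zero]
  have hF'R : ∀ (i : Fin m) (n : ℤ) (t : ℝ), (1 + ε₀) ^ ((20 : ℝ) * n) * |F' i n t| ≤ R := by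
    intro i n t
    rcases lt_or_ge n n₀ with hn | hn
    · rw [hF'0 i n t hn, abs_zero, mul_zero]
      exact hR0
    have hA'1 : |A'| ≤ |A| + 1 := by
      have := abs_sub_abs_le_abs_sub A' A
      linarith
    have h1 : (1 + ε₀) ^ ((20 : ℝ) * n) * |(if i = i₀ ∧ n = n₀ then A' else 0) * k i n t| ≤
        (1 + ε₀) ^ ((20 : ℝ) * n₀) * (|A| + 1) := by
      split_ifs with h
      · rw [abs_mul, h.2]
        calc (1 + ε₀) ^ ((20 : ℝ) * n₀) * (|A'| * |k i n₀ t|)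
            ≤ (1 + ε₀) ^ ((20 : ℝ) * n₀) * ((|A| + 1) * 1) := by
              gcongr
              exact hk1 i n₀ t
          _ = _ := by ring
      · rw [zero_mul, abs_zero, mul_zero]
        positivity
    have h2 := weighted_volterra_abs_le hε₀ α hρ hZcc hZcb ((hkc i n).comp (continuous_const.sub
      continuous_id)) (fun s => hk1 i n (t - s)) i hn ha (by linarith : a - 0 ≤ T)
    rw [← hK, ← hΛ₁] at h2
    rw [hF']
    calc (1 + ε₀) ^ ((20 : ℝ) * n) * |(if i = i₀ ∧ n = n₀ then A' else 0) * k i n t +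
          ∫ s in (0 : ℝ)..a, k i n (t - s) * quadTerm ε₀ α Zc i n s|
        ≤ (1 + ε₀) ^ ((20 : ℝ) * n) * (|(if i = i₀ ∧ n = n₀ then A' else 0) * k i n t| +
            |∫ s in (0 : ℝ)..a, k i n (t - s) * quadTerm ε₀ α Zc i n s|) :=
          mul_le_mul_of_nonneg_left (abs_add_le _ _) (Real.rpow_nonneg hL0.le _)
      _ ≤ (1 + ε₀) ^ ((20 : ℝ) * n₀) * (|A| + 1) + T * Λ₁ * (ρY + 1) := by
          rw [mul_add]
          exact add_le_add h1 h2
      _ ≤ R := hR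
  -- the Picard solution of the restarted chain of `Z` on `[a, b]`
  obtain ⟨W, hWc, hW0, hWb, hWeq⟩ := hP F' hF'c hF'0 hF'R
  -- `Y` solves its restarted chain on `[a, b]`
  have hInt : ∀ (j : Fin m) (k' : ℤ) (s c d : ℝ), uIcc c d ⊆ Icc 0 T →
      IntervalIntegrable (fun u => k j k' (s - u) * quadTerm ε₀ α Y j k' u) volume c d :=
    fun j k' s c d h => ((((hkc j k').comp (continuous_const.sub continuous_id)).continuousOn).mul
      ((quadTerm_continuousOn α hYc j k').mono h)).intervalIntegrable
  have hYeq' : ∀ (j : Fin m) (k' : ℤ), ∀ s ∈ Icc a b,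
      Y j k' s = F j k' s + ∫ u in a..s, k j k' (s - u) * quadTerm ε₀ α Y j k' u := by
    intro j k' s hs
    have hsT : s ∈ Icc 0 T := hIccT' hs
    have hI1 : ∫ u in (0 : ℝ)..a, k j k' (s - u) * quadTerm ε₀ α Yc j k' u =
        ∫ u in (0 : ℝ)..a, k j k' (s - u) * quadTerm ε₀ α Y j k' u :=
      intervalIntegral.integral_congr fun u hu => by
        rw [uIcc_of_le ha] at hu
        show k j k' (s - u) * quadTerm ε₀ α Yc j k' u = k j k' (s - u) * quadTerm ε₀ α Y j k' u
        rw [quadTerm_congr_at α (fun a' b' => hYcY a' b' u hu) j k']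
    rw [hF, hYeq j k' s hsT, add_assoc, hI1,
      intervalIntegral.integral_add_adjacent_intervals (hInt j k' s 0 a ?_) (hInt j k' s a s ?_)]
    · rw [uIcc_of_le ha]
      exact hIccT
    · rw [uIcc_of_le hs.1]
      exact fun u hu => ⟨ha.trans hu.1, hu.2.trans hsT.2⟩
  -- the two forcings are close
  have hFF' : ∀ (i : Fin m) (n : ℤ), ∀ t ∈ Icc a b, (1 + ε₀) ^ ((20 : ℝ) * n) * |F i n t - F' i n t| ≤
      (1 + ε₀) ^ ((20 : ℝ) * n₀) * |A' - A| + T * Λ₁ * D := by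
    intro i n t _
    rcases lt_or_ge n n₀ with hn | hn
    · rw [hF0 i n t hn, hF'0 i n t hn, sub_zero, abs_zero, mul_zero]
      positivity
    have h1 : (1 + ε₀) ^ ((20 : ℝ) * n) *
        |((if i = i₀ ∧ n = n₀ then A else 0) - (if i = i₀ ∧ n = n₀ then A' else 0)) * k i n t| ≤
        (1 + ε₀) ^ ((20 : ℝ) * n₀) * |A' - A| := by
      split_ifs with h
      · rw [abs_mul, h.2, abs_sub_comm]
        calc (1 + ε₀) ^ ((20 : ℝ) * n₀) * (|A' - A| * |k i n₀ t|)
            ≤ (1 + ε₀) ^ ((20 : ℝ) * n₀) * (|A' - A| * 1) := by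
              gcongr
              exact hk1 i n₀ t
          _ = _ := by ring
      · rw [sub_zero, zero_mul, abs_zero, mul_zero]
        positivity
    have h2 := weighted_volterra_sub_le hε₀ α hρ hD0 hYcc hZcc hYcb hZcb hdc
      ((hkc i n).comp (continuous_const.sub continuous_id)) (fun s => hk1 i n (t - s)) i hn ha
      (by linarith : a - 0 ≤ T)
    rw [← hK, ← hΛ₁] at h2
    have hsplit : F i n t - F' i n t =
        ((if i = i₀ ∧ n = n₀ then A else 0) - (if i = i₀ ∧ n = n₀ then A' else 0)) * k i n t +
          ((∫ s in (0 : ℝ)..a, k i n (t - s) * quadTerm ε₀ α Yc i n s) -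
            ∫ s in (0 : ℝ)..a, k i n (t - s) * quadTerm ε₀ α Zc i n s) := by
      rw [hF, hF']
      ring
    rw [hsplit]
    calc (1 + ε₀) ^ ((20 : ℝ) * n) *
          |((if i = i₀ ∧ n = n₀ then A else 0) - (if i = i₀ ∧ n = n₀ then A' else 0)) * k i n t +
            ((∫ s in (0 : ℝ)..a, k i n (t - s) * quadTerm ε₀ α Yc i n s) -
              ∫ s in (0 : ℝ)..a, k i n (t - s) * quadTerm ε₀ α Zc i n s)|
        ≤ (1 + ε₀) ^ ((20 : ℝ) * n) *
            (|((if i = i₀ ∧ n = n₀ then A else 0) - (if i = i₀ ∧ n = n₀ then A' else 0)) * k i n t| +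
              |(∫ s in (0 : ℝ)..a, k i n (t - s) * quadTerm ε₀ α Yc i n s) -
                ∫ s in (0 : ℝ)..a, k i n (t - s) * quadTerm ε₀ α Zc i n s|) :=
          mul_le_mul_of_nonneg_left (abs_add_le _ _) (Real.rpow_nonneg hL0.le _)
      _ ≤ _ := by
          rw [mul_add]
          exact add_le_add h1 h2
  -- the restarted chains are close on `[a, b]`
  have hη0 : 0 ≤ (1 + ε₀) ^ ((20 : ℝ) * n₀) * |A' - A| + T * Λ₁ * D := by positivity
  have hρ₂ : 0 ≤ 2 * R + 1 := by positivity
  have hdist := restart_dist_le hε₀ α k hk1 hkc hK hρ₂ hη0 hab (by rw [← hΛ₂]; exact hbΛ)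
    (fun i n => (hYc i n).mono hIccT') (fun i n => (hWc i n).continuousOn) hY0 hW0
    (fun i n t ht => (hYb i n t (hIccT' ht)).trans hRρ) (fun i n t _ => hWb i n t) hYeq' hWeq hFF'
  -- `W(a) = Z(a)`
  have hWZ : ∀ i n, W i n a = Z i n a := fun i n => by
    rw [hWeq i n a ⟨le_rfl, hab⟩, intervalIntegral.integral_same, add_zero, hF', hZeq i n a ⟨ha, le_rfl⟩]
    congr 1
    exact intervalIntegral.integral_congr fun u hu => by
      rw [uIcc_of_le ha] at hu
      show k i n (a - u) * quadTerm ε₀ α Zc i n u = k i n (a - u) * quadTerm ε₀ α Z i n u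
      rw [quadTerm_congr_at α (fun a' b' => hZcZ a' b' u hu) i n]
  -- glue at `a`
  obtain ⟨Z', hZ'⟩ : ∃ Z' : Fin m → ℤ → ℝ → ℝ, ∀ i n t, Z' i n t = if t ≤ a then Z i n t else W i n t :=
    ⟨_, fun _ _ _ => rfl⟩
  have hZ'Z : ∀ i n, ∀ t ∈ Icc 0 a, Z' i n t = Z i n t := fun i n t ht => by
    rw [hZ', if_pos ht.2]
  have hZ'W : ∀ i n, ∀ t ∈ Icc a b, Z' i n t = W i n t := fun i n t ht => by
    rw [hZ']
    split_ifs with h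
    · rw [le_antisymm h ht.1, hWZ]
    · rfl
  have hZ'c : ∀ i n, Continuous (Z' i n) := fun i n => by
    rw [show Z' i n = fun t => if t ≤ a then Z i n t else W i n t from funext (hZ' i n)]
    exact Continuous.if_le (hZc i n) (hWc i n) continuous_id continuous_const fun t ht => by
      rw [ht, hWZ]
  have hZ'0 : ∀ i n t, n < n₀ → Z' i n t = 0 := fun i n t hn => by
    rw [hZ']
    split_ifs
    exacts [hZ0 i n t hn, hW0 i n t hn]
  have hInt' : ∀ (j : Fin m) (k' : ℤ) (s c d : ℝ),
      IntervalIntegrable (fun u => k j k' (s - u) * quadTerm ε₀ α Z' j k' u) volume c d :=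
    fun j k' s c d => (((hkc j k').comp (continuous_const.sub continuous_id)).mul
      (continuous_quadTerm α hZ'c j k')).intervalIntegrable c d
  refine ⟨Z', hZ'c, hZ'0, fun i n t ht => ?_, fun i n t ht => ?_⟩
  · -- the chain identity on `[0, b]`
    rcases le_or_gt t a with h | h
    · rw [hZ'Z i n t ⟨ht.1, h⟩, hZeq i n t ⟨ht.1, h⟩]
      congr 1
      refine intervalIntegral.integral_congr fun s hs => ?_
      rw [uIcc_of_le ht.1] at hs
      show k i n (t - s) * quadTerm ε₀ α Z i n s = k i n (t - s) * quadTerm ε₀ α Z' i n s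
      rw [quadTerm_congr_at α (fun j k' => (hZ'Z j k' s ⟨hs.1, hs.2.trans h⟩).symm) i n]
    · rw [hZ'W i n t ⟨h.le, ht.2⟩, hWeq i n t ⟨h.le, ht.2⟩, hF', add_assoc]
      congr 1
      have hI1 : ∫ s in (0 : ℝ)..a, k i n (t - s) * quadTerm ε₀ α Zc i n s =
          ∫ s in (0 : ℝ)..a, k i n (t - s) * quadTerm ε₀ α Z' i n s :=
        intervalIntegral.integral_congr fun s hs => by
          rw [uIcc_of_le ha] at hs
          show k i n (t - s) * quadTerm ε₀ α Zc i n s = k i n (t - s) * quadTerm ε₀ α Z' i n s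
          rw [quadTerm_congr_at α (fun j k' => ?_) i n]
          rw [hZcZ j k' s hs, hZ'Z j k' s hs]
      have hI2 : ∫ s in a..t, k i n (t - s) * quadTerm ε₀ α W i n s =
          ∫ s in a..t, k i n (t - s) * quadTerm ε₀ α Z' i n s :=
        intervalIntegral.integral_congr fun s hs => by
          rw [uIcc_of_le h.le] at hs
          show k i n (t - s) * quadTerm ε₀ α W i n s = k i n (t - s) * quadTerm ε₀ α Z' i n s
          rw [quadTerm_congr_at α (fun j k' => (hZ'W j k' s ⟨hs.1, hs.2.trans ht.2⟩).symm) i n]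
      rw [hI1, hI2]
      exact intervalIntegral.integral_add_adjacent_intervals (hInt' i n t 0 a) (hInt' i n t a t)
  · -- the distance to `Y` on `[0, b]`
    have hd0 : 0 ≤ (1 + ε₀) ^ ((20 : ℝ) * n₀) * |A' - A| := by positivity
    have hTΛD : 0 ≤ T * Λ₁ * D := by positivity
    rcases le_or_gt t a with h | h
    · rw [hZ'Z i n t ⟨ht.1, h⟩]
      refine (hZd i n t ⟨ht.1, h⟩).trans ?_
      nlinarith
    · rw [hZ'W i n t ⟨h.le, ht.2⟩]
      refine (hdist i n t ⟨h.le, ht.2⟩).trans ?_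
      nlinarith

/-! ### The registered sub-goal -/

/-- **Registered sub-goal `stub_wellposedStep` of the stub `wellposed`** (`persist_step`, closed form):
one marching step of the persistence argument — a solution from the datum `A'` on `[0,a]`, `D`-close
(`D ≤ 1`, weight `20`) to the reference solution `Y` from `A` on `[0,T]`, extends under the Picard
solvability hypothesis to `[0,b]`, `2(1+ε₀)^{20n₀}|A'-A| + (2TΛ₁+1)D`-close to `Y`. [cite: Tao2016AveragedNS, §4 p. 22 (4.14)] -/
theorem stub_wellposedStep :
    ∀ {ε₀ : ℝ}, 0 < ε₀ → ∀ {m : ℕ} (α : Fin m → Fin m → Fin m → ℤ × ℤ × ℤ → ℝ)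
      (k : Fin m → ℤ → ℝ → ℝ), (∀ i n τ, |k i n τ| ≤ 1) → (∀ i n, Continuous (k i n)) →
      ∀ (i₀ : Fin m) (n₀ : ℤ) (K Λ₁ Λ₂ A A' T a b ρY R D : ℝ),
      K = (∑ i₃ : Fin m, ∑ i₁ : Fin m, ∑ i₂ : Fin m, ∑ μ ∈ TaoCascade.shiftSet, |α i₁ i₂ i₃ μ|) →
      Λ₁ = K * (2 * (ρY + 1)) * (1 + ε₀) ^ ((75 : ℝ) / 2 - (35 : ℝ) / 2 * n₀) →
      Λ₂ = K * (2 * (2 * R + 1)) * (1 + ε₀) ^ ((75 : ℝ) / 2 - (35 : ℝ) / 2 * n₀) →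
      0 ≤ a → a ≤ b → b ≤ T → 0 ≤ ρY → 0 ≤ D → D ≤ 1 → |A' - A| ≤ 1 →
      (1 + ε₀) ^ ((20 : ℝ) * n₀) * (|A| + 1) + T * Λ₁ * (ρY + 1) ≤ R → ρY ≤ 2 * R + 1 →
      (b - a) * Λ₂ ≤ 1 / 2 →
      (∀ F : Fin m → ℤ → ℝ → ℝ, (∀ i n, Continuous (F i n)) → (∀ i n t, n < n₀ → F i n t = 0) →
        (∀ (i : Fin m) (n : ℤ) (t : ℝ), (1 + ε₀) ^ ((20 : ℝ) * n) * |F i n t| ≤ R) →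
        ∃ X : Fin m → ℤ → ℝ → ℝ, (∀ i n, Continuous (X i n)) ∧ (∀ i n t, n < n₀ → X i n t = 0) ∧
          (∀ (i : Fin m) (n : ℤ) (t : ℝ), (1 + ε₀) ^ ((20 : ℝ) * n) * |X i n t| ≤ 2 * R + 1) ∧
          (∀ (i : Fin m) (n : ℤ), ∀ t ∈ Icc a b,
            X i n t = F i n t + ∫ s in a..t, k i n (t - s) * quadTerm ε₀ α X i n s)) →
      ∀ (Y Z : Fin m → ℤ → ℝ → ℝ),
      (∀ i n, ContinuousOn (Y i n) (Icc 0 T)) → (∀ i n t, n < n₀ → Y i n t = 0) →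
      (∀ (i : Fin m) (n : ℤ), ∀ t ∈ Icc 0 T, (1 + ε₀) ^ ((20 : ℝ) * n) * |Y i n t| ≤ ρY) →
      (∀ (i : Fin m) (n : ℤ), ∀ t ∈ Icc 0 T,
        Y i n t = (if i = i₀ ∧ n = n₀ then A else 0) * k i n t +
          ∫ s in (0 : ℝ)..t, k i n (t - s) * quadTerm ε₀ α Y i n s) →
      (∀ i n, Continuous (Z i n)) → (∀ i n t, n < n₀ → Z i n t = 0) →
      (∀ (i : Fin m) (n : ℤ), ∀ t ∈ Icc 0 a,
        Z i n t = (if i = i₀ ∧ n = n₀ then A' else 0) * k i n t +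
          ∫ s in (0 : ℝ)..t, k i n (t - s) * quadTerm ε₀ α Z i n s) →
      (∀ (i : Fin m) (n : ℤ), ∀ t ∈ Icc 0 a, (1 + ε₀) ^ ((20 : ℝ) * n) * |Y i n t - Z i n t| ≤ D) →
      ∃ Z' : Fin m → ℤ → ℝ → ℝ, (∀ i n, Continuous (Z' i n)) ∧ (∀ i n t, n < n₀ → Z' i n t = 0) ∧
        (∀ (i : Fin m) (n : ℤ), ∀ t ∈ Icc 0 b,
          Z' i n t = (if i = i₀ ∧ n = n₀ then A' else 0) * k i n t +
            ∫ s in (0 : ℝ)..t, k i n (t - s) * quadTerm ε₀ α Z' i n s) ∧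
        ∀ (i : Fin m) (n : ℤ), ∀ t ∈ Icc 0 b, (1 + ε₀) ^ ((20 : ℝ) * n) * |Y i n t - Z' i n t| ≤
          2 * ((1 + ε₀) ^ ((20 : ℝ) * n₀) * |A' - A|) + (2 * (T * Λ₁) + 1) * D :=
  fun hε₀ _ α k hk1 hkc i₀ n₀ _ _ _ _ _ _ _ _ _ _ _ hK hΛ₁ hΛ₂ ha hab hbT hρY hD0 hD1 hA' hR hRρ hbΛ hP _ _
      hYc hY0 hYb hYeq hZc hZ0 hZeq hZd =>
    persist_step hε₀ α k hk1 hkc i₀ n₀ hK hΛ₁ hΛ₂ ha hab hbT hρY hD0 hD1 hA' hR hRρ hbΛ hP hYc hY0 hYb hYeq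
      hZc hZ0 hZeq hZd

end Summit.NavierStokesRegularity.NavierStokesRegularity.Theorems.PerpetualPumpAveragedTypeIBlowup

end
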